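import Summits.SmoothPoincare4.SmoothPoincare4.Theorems.SblfDescentRungOneHelperFoldNFPageHessianChart
import Literature.Topology.FourManifolds.FibrewiseMorseLocalFrame
import Literature.Topology.FourManifolds.SimplifiedBrokenLefschetzRoundSlices
import HarnessLib

/-!
# The page Hessians of the height along the round circle: nondegenerate of index one

Helper `helper_foldNF_pageHessian` of stub `helper_sliceGluing_foldNormalForm` (the
`S¹`-parametric fold normal form of the round circle), line `Sketch`, crux `SblfDescent.RungOne`.

(Crux item stmt-SmoothPoincare4-18531; skeleton `Cruxes/RungOne/Lines/Sketch.lean`.)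

From the fold-chart computation `helper_foldNF_pageHessianAt` (`H_t (a, b) = c_t · 2 B (P_t a,
P_t b)`, `c_t ≠ 0`, `P_t` injective, `c_0 > 0`) we deduce that EVERY page Hessian `H_t` of the
height family `g (t, x) = ⟪v, f (ν₀ (circlePt t, x))⟫` along the round circle is nondegenerate
and congruent to a POSITIVE multiple of `2 B`, `B (a, b) = a₀b₀ + a₁b₁ - a₂b₂` — i.e. has index
`1`, with a pointwise adapted frame `√c_t P_t`.  The sign of `c_t` is read by the negative index
of inertia `sigNeg H_t ∈ {1, 2}`, which is locally constant along the nondegenerate family (local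
adapted frames, Hirsch 1976 Ch. 6 §1 Lemma p. 145, the tree's `Splitting.exists_local_adaptedFrame`
and `Splitting.sigNeg_eq_of_congruent`), hence constant on `ℝ`, hence equal to its value `1` at
`t = 0`.  This is the pointwise input of the residual `helper_foldNF_frame` (a PERIODIC smooth
adapted frame = untwistedness of the round handle).

## References

* M. W. Hirsch, *Differential Topology*, GTM 33 (1976), Ch. 6 §1. [HirschDT1976]
* K. Hayano, *On genus-1 simplified broken Lefschetz fibrations*, Algebr. Geom. Topol. 11
  (2011), Def. 2.1 (4). [Hayano2011]
-/

set_option linter.dupNamespace false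

noncomputable section

open scoped Manifold ContDiff Topology RealInnerProductSpace
open Set Function Filter Metric Literature.Topology.FourManifolds
  Literature.AlgebraicTopology.SingularHomology

namespace Summit.SmoothPoincare4.SmoothPoincare4.Cruxes.RungOne.Sketch

/-- Local notation: `𝔼 n` is the model Euclidean space `EuclideanSpace ℝ (Fin n)`. -/
local notation "𝔼 " n:arg => EuclideanSpace ℝ (Fin n)

/-- Local notation: `𝕊²`, the unit sphere of `ℝ³`. -/
local notation "𝕊²" => (Metric.sphere (0 : EuclideanSpace ℝ (Fin 3)) (1 : ℝ))

attribute [local instance] Literature.Topology.FourManifolds.fact_finrank_euclideanSpace_succ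

/-- **Index of a form congruent to a multiple of the standard index-one form.**  If
`H (a, b) = c · 2 B (P a, P b)` with `c ≠ 0` and `P : ℝ³ → ℝ³` injective, then `H` is
nondegenerate and `sigNeg H = 1` if `c > 0`, `= 2` if `c < 0` (congruence invariance and
Sylvester's count for `2c (a₀b₀ + a₁b₁ - a₂b₂)`). [folklore] -/
theorem nondegenerate_and_sigNeg_of_congruent_sliceForm (H : 𝔼 3 →L[ℝ] 𝔼 3 →L[ℝ] ℝ) {c : ℝ}
    (hc : c ≠ 0) {P : 𝔼 3 →L[ℝ] 𝔼 3} (hP : Injective P)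
    (hH : ∀ a b : 𝔼 3, H a b = c * (2 * ((P a) 0 * (P b) 0 + (P a) 1 * (P b) 1 - (P a) 2 * (P b) 2))) :
    (∀ a : 𝔼 3, (∀ b : 𝔼 3, H a b = 0) → a = 0) ∧
      sigNeg ((H.toBilinForm).toQuadraticMap) = if 0 < c then 1 else 2 := by
  obtain ⟨B, hB⟩ := exists_clm_sliceForm
  set Pe : 𝔼 3 ≃L[ℝ] 𝔼 3 := (LinearEquiv.ofInjectiveEndo P.toLinearMap hP).toContinuousLinearEquiv
    with hPe
  have hPe' : ∀ a, Pe a = P a := fun a => rfl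
  have hcong : ∀ a b : 𝔼 3, H a b = ((2 * c) • B) (Pe a) (Pe b) := fun a b => by
    rw [hH, hPe', hPe']
    simp only [smul_apply, smul_eq_mul, hB]
    ring
  refine ⟨fun a ha => ?_, ?_⟩
  · -- nondegeneracy: `P a` is `B`-orthogonal to the whole space
    have hPa : ∀ y : 𝔼 3, B (Pe a) y = 0 := fun y => by
      have := ha (Pe.symm y)
      rw [hcong, ContinuousLinearEquiv.apply_symm_apply] at this
      simp only [smul_apply, smul_eq_mul, mul_eq_zero] at this
      rcases this with (h | h) | h
      · norm_num at h
      · exact absurd h hc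
      · exact h
    have h0 := hPa (EuclideanSpace.single 0 1)
    have h1 := hPa (EuclideanSpace.single 1 1)
    have h2 := hPa (EuclideanSpace.single 2 1)
    simp [hB] at h0 h1 h2
    have hz : Pe a = 0 := by
      ext i; fin_cases i
      · simpa using h0
      · simpa using h1
      · simpa using h2
    simpa using congrArg Pe.symm hz
  · rw [Splitting.sigNeg_eq_of_congruent H ((2 * c) • B) Pe hcong]
    exact sigNeg_of_forall_apply_eq_sliceForm ((2 * c) • B).toBilinForm hc (fun a b => by
      rw [ContinuousLinearMap.toBilinForm_apply]
      simp only [smul_apply, smul_eq_mul, hB]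
      ring)

/-- **The page Hessians along the round circle are nondegenerate of index one.**  For a genus-one
Lefschetz-free SBLF with equatorial round image, torus-side pole `v`, round circle `e` and tube
`ν₀`: for every `t`, the page Hessian `H_t = ∂ₓ∂ₓ g (t, 0)` of
`g (t, x) = ⟪v, f (ν₀ (circlePt t, x))⟫` is nondegenerate and equals `c · 2 B (P a, P b)` with
`c > 0`, `P` injective, `B (a, b) = a₀b₀ + a₁b₁ - a₂b₂` (so `√c P` is a pointwise adapted
frame).  [The sign is that at `t = 0`, propagated along the connected parameter line by the local
constancy of the index of a nondegenerate family.] [cite: HirschDT1976, Ch. 6 §1]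
[cite: Hayano2011, Def. 2.1 (4)] -/
theorem helper_foldNF_pageHessian : ∀ (X : Type) [TopologicalSpace X] [T2Space X] [SecondCountableTopology X] [CompactSpace X] [ChartedSpace (𝔼 4) X] [IsManifold (𝓡 4) ∞ X] (o : SmoothOrientation (𝓡 4) X) (f : X → 𝕊²), IsSimplifiedBrokenLefschetzFibration o f ∅ 0 → f '' ({p : X | ¬ Surjective (mfderiv (𝓡 4) (𝓡 2) f p)} \ (↑(∅ : Finset X) : Set X)) = sphereEquator 1 → ∀ (v : 𝕊²), (v : 𝔼 3) 0 = 0 → (v : 𝔼 3) 1 = 0 → (∀ y : 𝕊², ⟪(y : 𝔼 3), (v : 𝔼 3)⟫ < 0 → (∀ q, f q = y → Surjective (mfderiv (𝓡 4) (𝓡 2) f q)) ∧ Nonempty ((Fin (2 * 0) → ℤ) ≃ₗ[ℤ] singularHomology ℤ ℤ ↥(f ⁻¹' {y}) 1)) → (∀ y : 𝕊², ⟪(y : 𝔼 3), ((-v : 𝕊²) : 𝔼 3)⟫ < 0 → (∀ q, f q = y → Surjective (mfderiv (𝓡 4) (𝓡 2) f q)) ∧ Nonempty ((Fin (2 * (0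 + 1)) → ℤ) ≃ₗ[ℤ] singularHomology ℤ ℤ ↥(f ⁻¹' {y}) 1)) → ∀ (e : Metric.sphere (0 : 𝔼 2) 1 → X) (ν₀ : CircleNbhd (𝓡 4) e), Set.range e = {p : X | ¬ Surjective (mfderiv (𝓡 4) (𝓡 2) f p)} \ (↑(∅ : Finset X) : Set X) → (∀ u, f (e u) = sphereInclusion 1 2 one_le_two u) → ∀ t : ℝ, (∀ a : 𝔼 3, (∀ b : 𝔼 3, fderiv ℝ (fderiv ℝ (fun q : ℝ × 𝔼 3 => SphereHeight.height (v : 𝔼 3) (f (ν₀.toFun (circlePt q.1, q.2))))) (t, 0) ((0 : ℝ), a) ((0 : ℝ), b) = 0) → a = 0) ∧ ∃ (c : ℝ) (P : 𝔼 3 →L[ℝ] 𝔼 3), 0 < c ∧ Function.Injective P ∧ ∀ a b : 𝔼 3, fderiv ℝ (fderiv ℝ (fun q : ℝ × 𝔼 3 => SphereHeight.height (v : 𝔼 3) (f (ν₀.toFun (circlePt q.1, q.2))))) (t, 0) ((0 : ℝ), a) ((0 : ℝ), b) = c * (2 * ((P a) 0 * (P b) 0 + (P a) 1 * (P b) 1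 - (P a) 2 * (P b) 2)) := by
  intro X _ _ _ _ _ _ o f hf hround v hv0 hv1 hlo hhi e ν₀ hrange hfe
  have hAt := helper_foldNF_pageHessianAt X o f hf hround v hv0 hv1 hlo hhi e ν₀ hrange hfe
  obtain ⟨-, -, -, hgs, -, -, -⟩ := helper_foldNF_family X o f hf hround v hv0 hv1 e ν₀ hrange hfe
  set g : ℝ × 𝔼 3 → ℝ := fun q => SphereHeight.height (v : 𝔼 3) (f (ν₀.toFun (circlePt q.1, q.2)))
    with hgdef
  -- the family of page Hessians as bilinear maps
  set Hf : ℝ → 𝔼 3 →L[ℝ] 𝔼 3 →L[ℝ] ℝ := fun t =>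
    (fderiv ℝ (fderiv ℝ g) (t, 0)).bilinearComp (ContinuousLinearMap.inr ℝ ℝ (𝔼 3))
      (ContinuousLinearMap.inr ℝ ℝ (𝔼 3)) with hHf
  have hHap : ∀ (t : ℝ) (a b : 𝔼 3), Hf t a b = fderiv ℝ (fderiv ℝ g) (t, 0) ((0 : ℝ), a) ((0 : ℝ), b) :=
    fun t a b => by simp [hHf]
  -- nondegeneracy and the index dichotomy at each `t`
  have hnd : ∀ (t : ℝ) (a : 𝔼 3),
      (∀ b : 𝔼 3, fderiv ℝ (fderiv ℝ g) (t, 0) ((0 : ℝ), a) ((0 : ℝ), b) = 0) → a = 0 := by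
    intro t a ha
    obtain ⟨c, P, hc, hP, hH, -⟩ := hAt t
    exact (nondegenerate_and_sigNeg_of_congruent_sliceForm (Hf t) hc hP
      (fun a b => by rw [hHap]; exact hH a b)).1 a (fun b => by rw [hHap]; exact ha b)
  set σ : ℝ → ℕ := fun t => sigNeg (((Hf t).toBilinForm).toQuadraticMap) with hσ
  have hσc : ∀ t : ℝ, ∀ {c : ℝ} {P : 𝔼 3 →L[ℝ] 𝔼 3}, c ≠ 0 → Injective P →
      (∀ a b : 𝔼 3, fderiv ℝ (fderiv ℝ g) (t, 0) ((0 : ℝ), a) ((0 : ℝ), b) =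
        c * (2 * ((P a) 0 * (P b) 0 + (P a) 1 * (P b) 1 - (P a) 2 * (P b) 2))) →
      σ t = if 0 < c then 1 else 2 := fun t c P hc hP hH =>
    (nondegenerate_and_sigNeg_of_congruent_sliceForm (Hf t) hc hP
      (fun a b => by rw [hHap]; exact hH a b)).2
  -- `σ` is locally constant (local adapted frames), hence constant
  have hloc : IsLocallyConstant σ := by
    refine (IsLocallyConstant.iff_eventually_eq σ).2 fun m => ?_
    obtain ⟨U, Fr, Frinv, hU, hm, -, -, -, hri, hli, had⟩ :=
      Splitting.exists_local_adaptedFrame (P := ℝ) hgs hnd m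
    filter_upwards [hU.mem_nhds hm] with t ht
    have hFrinj : Injective (Fr t) := fun a b hab => by
      have := congrArg (Frinv t) hab
      rwa [hli t ht, hli t ht] at this
    set Fe : 𝔼 3 ≃L[ℝ] 𝔼 3 :=
      (LinearEquiv.ofInjectiveEndo (Fr t).toLinearMap hFrinj).toContinuousLinearEquiv with hFe
    refine Splitting.sigNeg_eq_of_congruent (Hf t) (Hf m) Fe fun a b => ?_
    rw [hHap, hHap]
    exact had t ht a b
  have hσ0 : σ 0 = 1 := by
    obtain ⟨c, P, hc, hP, hH, h0⟩ := hAt 0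
    rw [hσc 0 hc hP hH, if_pos (h0 rfl)]
  intro t
  refine ⟨hnd t, ?_⟩
  obtain ⟨c, P, hc, hP, hH, -⟩ := hAt t
  have hct : σ t = if 0 < c then 1 else 2 := hσc t hc hP hH
  rw [hloc.apply_eq_of_preconnectedSpace t 0, hσ0] at hct
  have hcpos : 0 < c := by
    by_contra hneg
    rw [if_neg hneg] at hct
    norm_num at hct
  exact ⟨c, P, hcpos, hP, hH⟩

end Summit.SmoothPoincare4.SmoothPoincare4.Cruxes.RungOne.Sketch

end
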